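import Literature.Geometry.Manifold.FramedCharts
import HarnessLib

/-!
# Quasilinear operators in framed charts (topic `Analysis/PDE`)

Layer (III), step 1a, of the programme to prove short-time existence for quasilinear strictly
parabolic systems on a closed manifold (hypothesis `hQL` of
`Literature.Geometry.Riemannian.ricciFlow_shortTime_existence_of_quasilinear`). The hypothesis
`hQL` describes the operator `P` in the extended charts `extChartAt I z` with coefficients
`a z, f z` of the `1`-jet; the analysis of layer (III) runs in the *framed* charts
`κ = (z, A, c)` of a patch system (`FramedCharts.lean`), whose chart maps are
`x ↦ A (extChartAt I z x) + c`. This file transports the representation: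

* `comp_extChartAt_symm_eq` — `u ∘ (extChartAt I z)⁻¹ = (u ∘ κ⁻¹) ∘ (A · + c)`;
* `fderiv_comp_extChartAt_symm`, `fderiv_fderiv_comp_extChartAt_symm` — first and second
  derivatives through the affine map;
* `chartNonlin κ a f y w D H` — the chart nonlinearity
  `Σᵢᵢ' a z (A⁻¹(y - c), w, D ∘ A) i i' • H (A bᵢ) (A bᵢ') + f z (A⁻¹(y - c), w, D ∘ A)`;
* `apply_inv_eq_chartNonlin` — **the representation in the framed chart**: under the chart
  representation of `hQL` at the base point `z`, for smooth `u` with graph in `𝒪` and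
  `y ∈ κ.target`, `P u (κ⁻¹ y) = chartNonlin κ a f y (û y) (Dû y) (D²û y)`, `û = u ∘ κ⁻¹`;
* `contMDiff_of_contDiffOn_comp_inv` — a map whose framed-chart expressions are smooth on a
  family of charts covering `M` is smooth.

Everything is proved; no named fact and no `sorry` is introduced.

## References

* C. Mantegazza, L. Martinazzi, *A note on quasilinear parabolic equations on manifolds*,
  Ann. Sc. Norm. Super. Pisa Cl. Sci. (5) 11 (2012), 857–874, §2. [MantegazzaMartinazzi2012]
* J. M. Lee, *Introduction to Smooth Manifolds*, 2nd ed., Springer 2013, Ch. 1. [Lee2013]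
-/

noncomputable section

open Set Function Filter Topology
open scoped Manifold ContDiff Topology

namespace Literature.Geometry.Manifold

namespace FramedChart

variable {E : Type*} [NormedAddCommGroup E] [NormedSpace ℝ E] {H : Type*} [TopologicalSpace H]
variable {I : ModelWithCorners ℝ E H} {M : Type*} [TopologicalSpace M] [ChartedSpace H M]
variable {E' : Type*} [NormedAddCommGroup E'] [NormedSpace ℝ E']
variable {W : Type*} [NormedAddCommGroup W] [NormedSpace ℝ W]
variable (κ : FramedChart I M E')

/-! ### The affine change of variables -/

/-- The affine part of the framed chart: `η ↦ A η + c`. [cite: Lee2013, Ch. 1] -/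
def affine (η : E) : E' := κ.A η + κ.c

/-- `affine_apply`: unfolding. [folklore] -/
theorem affine_apply (η : E) : κ.affine η = κ.A η + κ.c := rfl

/-- `inv ∘ affine = (extChartAt I z)⁻¹`. [folklore] -/
theorem inv_affine (η : E) : κ.inv (κ.affine η) = (extChartAt I κ.z).symm η := by
  rw [inv_apply, affine_apply, affine_symm_apply]

/-- The affine map is smooth with derivative `A`. [folklore] -/
theorem hasFDerivAt_affine (η : E) : HasFDerivAt κ.affine (κ.A : E →L[ℝ] E') η := by
  have h : HasFDerivAt (fun η : E ↦ (κ.A : E →L[ℝ] E') η + κ.c) (κ.A : E →L[ℝ] E') η :=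
    ((κ.A : E →L[ℝ] E').hasFDerivAt).add_const κ.c
  exact h

/-- The affine map is smooth (every differentiability class). [folklore] -/
theorem contDiff_affine {n : WithTop ℕ∞} : ContDiff ℝ n κ.affine := (κ.A : E →L[ℝ] E').contDiff.add contDiff_const

/-- Points of the extended-chart target are sent into the framed target. [folklore] -/
theorem affine_mem_target {η : E} (hη : η ∈ (extChartAt I κ.z).target) : κ.affine η ∈ κ.target := ⟨η, hη, rfl⟩

omit [NormedAddCommGroup W] [NormedSpace ℝ W] in
/-- **The chart expressions in the extended and in the framed chart**:
`u ∘ (extChartAt I z)⁻¹ = (u ∘ κ⁻¹) ∘ (A · + c)`. [folklore] -/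
theorem comp_extChartAt_symm_eq (u : M → W) : u ∘ (extChartAt I κ.z).symm = (u ∘ κ.inv) ∘ κ.affine := by
  funext η
  simp only [Function.comp_apply, inv_affine]

/-- **First derivatives through the affine map**: if `û = u ∘ κ⁻¹` is differentiable at
`A η + c` then `D(u ∘ (extChartAt I z)⁻¹)(η) = Dû(A η + c) ∘ A`. [folklore] -/
theorem fderiv_comp_extChartAt_symm (u : M → W) {η : E} (hu : DifferentiableAt ℝ (u ∘ κ.inv) (κ.affine η)) :
    fderiv ℝ (u ∘ (extChartAt I κ.z).symm) η = fderiv ℝ (u ∘ κ.inv) (κ.affine η) ∘L (κ.A : E →L[ℝ] E') := by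
  rw [comp_extChartAt_symm_eq]
  exact (hu.hasFDerivAt.comp η (κ.hasFDerivAt_affine η)).fderiv

/-- **Second derivatives through the affine map**: if `û = u ∘ κ⁻¹` is `C²` near `A η + c` then
`D²(u ∘ (extChartAt I z)⁻¹)(η) v v' = D²û(A η + c) (A v) (A v')`. [folklore] -/
theorem fderiv_fderiv_comp_extChartAt_symm (u : M → W) {η : E} {U : Set E'} (hU : IsOpen U) (hηU : κ.affine η ∈ U)
    (hu : ContDiffOn ℝ 2 (u ∘ κ.inv) U) (v v' : E) :
    fderiv ℝ (fderiv ℝ (u ∘ (extChartAt I κ.z).symm)) η v v' =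
      fderiv ℝ (fderiv ℝ (u ∘ κ.inv)) (κ.affine η) (κ.A v) (κ.A v') := by
  -- near `η` the first derivative is `Dû(affine ·) ∘ A`
  have hpre : κ.affine ⁻¹' U ∈ 𝓝 η := (hU.preimage (κ.contDiff_affine (n := 0)).continuous).mem_nhds hηU
  have hdiff : ∀ η' ∈ κ.affine ⁻¹' U, DifferentiableAt ℝ (u ∘ κ.inv) (κ.affine η') := fun η' hη' ↦
    (hu.differentiableOn (by norm_num)).differentiableAt (hU.mem_nhds hη')
  have hev : fderiv ℝ (u ∘ (extChartAt I κ.z).symm) =ᶠ[𝓝 η]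
      fun η' ↦ (fderiv ℝ (u ∘ κ.inv) (κ.affine η')) ∘L (κ.A : E →L[ℝ] E') := by
    filter_upwards [hpre] with η' hη'
    exact κ.fderiv_comp_extChartAt_symm u (hdiff η' hη')
  rw [hev.fderiv_eq]
  -- differentiate the composition `η' ↦ Dû(affine η') ∘ A`
  have hD : DifferentiableAt ℝ (fderiv ℝ (u ∘ κ.inv)) (κ.affine η) := by
    have h := (hu.fderiv_of_isOpen (m := 1) hU (by norm_num)).differentiableOn one_ne_zero
    exact h.differentiableAt (hU.mem_nhds hηU)
  have h1 : HasFDerivAt (fun η' ↦ fderiv ℝ (u ∘ κ.inv) (κ.affine η')) (fderiv ℝ (fderiv ℝ (u ∘ κ.inv)) (κ.affine η) ∘L (κ.A : E →L[ℝ] E')) η :=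
    hD.hasFDerivAt.comp η (κ.hasFDerivAt_affine η)
  have h2 : HasFDerivAt (fun η' ↦ (fderiv ℝ (u ∘ κ.inv) (κ.affine η')) ∘L (κ.A : E →L[ℝ] E'))
      ((ContinuousLinearMap.compL ℝ E E' W).flip (κ.A : E →L[ℝ] E') ∘L (fderiv ℝ (fderiv ℝ (u ∘ κ.inv)) (κ.affine η) ∘L (κ.A : E →L[ℝ] E'))) η := by
    have h3 := ((ContinuousLinearMap.compL ℝ E E' W).flip (κ.A : E →L[ℝ] E')).hasFDerivAt.comp η h1
    exact h3
  rw [h2.fderiv]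
  rfl

/-! ### The chart nonlinearity -/

variable {ι : Type*} [Fintype ι] (b : Module.Basis ι ℝ E)

/-- **The pulled-back jet**: the `1`-jet `(η, w, D ∘ A)` in the extended chart corresponding to
the jet `(y, w, D)` in the framed chart, `η = A⁻¹ (y - c)`. [cite: MantegazzaMartinazzi2012, §2] -/
def jetBack (y : E') (w : W) (D : E' →L[ℝ] W) : E × W × (E →L[ℝ] W) := (κ.A.symm (y - κ.c), w, D ∘L (κ.A : E →L[ℝ] E'))

/-- `jetBack_apply`: unfolding. [folklore] -/
theorem jetBack_apply (y : E') (w : W) (D : E' →L[ℝ] W) :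
    κ.jetBack y w D = (κ.A.symm (y - κ.c), w, D ∘L (κ.A : E →L[ℝ] E')) := rfl

/-- **The chart nonlinearity** of the quasilinear operator with coefficients `a, f` (of the base
point `z` of the chart) in the framed chart:
`𝒩(y, w, D, H) = Σᵢᵢ' a z (jetBack y w D) i i' • H (A bᵢ) (A bᵢ') + f z (jetBack y w D)`.
[cite: MantegazzaMartinazzi2012, §2] -/
def chartNonlin (a : M → E × W × (E →L[ℝ] W) → ι → ι → ℝ) (f : M → E × W × (E →L[ℝ] W) → W)
    (y : E') (w : W) (D : E' →L[ℝ] W) (H' : E' →L[ℝ] E' →L[ℝ] W) : W :=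
  (∑ i, ∑ i', a κ.z (κ.jetBack y w D) i i' • H' (κ.A (b i)) (κ.A (b i'))) + f κ.z (κ.jetBack y w D)

/-- `chartNonlin_apply`: unfolding. [folklore] -/
theorem chartNonlin_apply (a : M → E × W × (E →L[ℝ] W) → ι → ι → ℝ) (f : M → E × W × (E →L[ℝ] W) → W)
    (y : E') (w : W) (D : E' →L[ℝ] W) (H' : E' →L[ℝ] E' →L[ℝ] W) :
    κ.chartNonlin b a f y w D H' = (∑ i, ∑ i', a κ.z (κ.jetBack y w D) i i' • H' (κ.A (b i)) (κ.A (b i'))) + f κ.z (κ.jetBack y w D) := rfl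

/-- **The representation in the framed chart.** If `P` is represented in the extended chart at
`z` by the coefficients `a z, f z` on smooth `u` with graph in `𝒪` (the hypothesis of `hQL` at
`z`), then for such `u`, chart-smooth near `κ⁻¹ y`, and `y ∈ κ.target`:
`P u (κ⁻¹ y) = chartNonlin (y, û y, Dû y, D²û y)`, `û = u ∘ κ⁻¹`.
[cite: MantegazzaMartinazzi2012, §2] -/
theorem apply_inv_eq_chartNonlin {P : (M → W) → M → W}
    {a : M → E × W × (E →L[ℝ] W) → ι → ι → ℝ} {f : M → E × W × (E →L[ℝ] W) → W} {u : M → W}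
    (hrep : ∀ y ∈ (extChartAt I κ.z).target,
      P u ((extChartAt I κ.z).symm y) =
        (∑ i, ∑ i', a κ.z (y, u ((extChartAt I κ.z).symm y), fderiv ℝ (u ∘ (extChartAt I κ.z).symm) y) i i' •
          fderiv ℝ (fderiv ℝ (u ∘ (extChartAt I κ.z).symm)) y (b i) (b i')) +
        f κ.z (y, u ((extChartAt I κ.z).symm y), fderiv ℝ (u ∘ (extChartAt I κ.z).symm) y))
    {U : Set E'} (hU : IsOpen U) (hu : ContDiffOn ℝ 2 (u ∘ κ.inv) U) {y : E'} (hy : y ∈ κ.target) (hyU : y ∈ U) :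
    P u (κ.inv y) = κ.chartNonlin b a f y (u (κ.inv y)) (fderiv ℝ (u ∘ κ.inv) y) (fderiv ℝ (fderiv ℝ (u ∘ κ.inv)) y) := by
  set η : E := κ.A.symm (y - κ.c) with hη
  have hηt : η ∈ (extChartAt I κ.z).target := (κ.mem_target_iff y).1 hy
  have hyη : κ.affine η = y := κ.affine_apply_symm y
  have h1 := hrep η hηt
  rw [show (extChartAt I κ.z).symm η = κ.inv y by rw [← κ.inv_affine, hyη]] at h1
  rw [h1, chartNonlin_apply, jetBack_apply]
  have hD : DifferentiableAt ℝ (u ∘ κ.inv) (κ.affine η) := by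
    rw [hyη]; exact (hu.differentiableOn (by norm_num)).differentiableAt (hU.mem_nhds hyU)
  have hfd : fderiv ℝ (u ∘ (extChartAt I κ.z).symm) η = fderiv ℝ (u ∘ κ.inv) y ∘L (κ.A : E →L[ℝ] E') := by
    rw [κ.fderiv_comp_extChartAt_symm u hD, hyη]
  have hfdd : ∀ i i', fderiv ℝ (fderiv ℝ (u ∘ (extChartAt I κ.z).symm)) η (b i) (b i') =
      fderiv ℝ (fderiv ℝ (u ∘ κ.inv)) y (κ.A (b i)) (κ.A (b i')) := fun i i' ↦ by
    rw [κ.fderiv_fderiv_comp_extChartAt_symm u hU (by rwa [hyη]) hu, hyη]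
  simp only [hfd, hfdd, ← hη]

end FramedChart

/-! ### Smoothness from framed-chart expressions -/

section Smooth

variable {E : Type*} [NormedAddCommGroup E] [NormedSpace ℝ E] {H : Type*} [TopologicalSpace H]
variable {I : ModelWithCorners ℝ E H} {M : Type*} [TopologicalSpace M] [ChartedSpace H M]
variable {E' : Type*} [NormedAddCommGroup E'] [NormedSpace ℝ E']
variable {W : Type*} [NormedAddCommGroup W] [NormedSpace ℝ W]

/-- **Smoothness from a framed-chart expression**: if `u ∘ κ⁻¹` is `C^n` on the target of a
framed chart `κ` (boundaryless model) then `u` is `C^n` at every point of the source of `κ`.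
[cite: Lee2013, Ch. 1] -/
theorem FramedChart.contMDiffAt_of_contDiffOn_comp_inv [I.Boundaryless] {n : WithTop ℕ∞} [IsManifold I n M]
    (κ : FramedChart I M E') {u : M → W} (hu : ContDiffOn ℝ n (u ∘ κ.inv) κ.target) {x : M} (hx : x ∈ κ.source) :
    ContMDiffAt I 𝓘(ℝ, W) n u x := by
  have hxs : x ∈ (chartAt H κ.z).source := by rwa [← extChartAt_source I κ.z]
  rw [contMDiffAt_iff_of_mem_source (I' := 𝓘(ℝ, W)) (n := n) hxs (y := u x) (by simp)]
  -- the chart expression through the framed chart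
  have hexpr : u ∘ (extChartAt I κ.z).symm = (u ∘ κ.inv) ∘ κ.affine := κ.comp_extChartAt_symm_eq u
  have hη : (extChartAt I κ.z) x ∈ (extChartAt I κ.z).target := (extChartAt I κ.z).map_source (by rwa [extChartAt_source])
  have hcd : ContDiffWithinAt ℝ n (u ∘ (extChartAt I κ.z).symm) (extChartAt I κ.z).target ((extChartAt I κ.z) x) := by
    rw [hexpr]
    refine (hu _ (κ.affine_mem_target hη)).comp _ κ.contDiff_affine.contDiffWithinAt fun η hη' ↦ κ.affine_mem_target hη'
  have hcd' : ContDiffAt ℝ n (u ∘ (extChartAt I κ.z).symm) ((extChartAt I κ.z) x) :=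
    hcd.contDiffAt ((isOpen_extChartAt_target κ.z).mem_nhds hη)
  refine ⟨?_, ?_⟩
  · -- continuity at `x`
    have h1 : ContinuousAt (u ∘ (extChartAt I κ.z).symm) ((extChartAt I κ.z) x) := hcd'.continuousAt
    have h2 : ContinuousAt (extChartAt I κ.z) x := continuousAt_extChartAt' (by rwa [extChartAt_source])
    have h3 := h1.comp h2
    have heq : (u ∘ (extChartAt I κ.z).symm) ∘ (extChartAt I κ.z) =ᶠ[𝓝 x] u := by
      filter_upwards [extChartAt_source_mem_nhds' (by rwa [extChartAt_source] : x ∈ (extChartAt I κ.z).source)] with x' hx'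
      simp only [Function.comp_apply, (extChartAt I κ.z).left_inv hx']
    exact h3.congr heq
  · simp only [extChartAt_model_space_eq_id, PartialEquiv.refl_coe, id_comp]
    exact hcd'.contDiffWithinAt

end Smooth

end Literature.Geometry.Manifold
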